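import Summits.ResolutionOfSingularities.ResolutionOfSingularities.Theorems.HilbertSamuelEliminationCampaignW42ConeRidgeDimPrime
import Summits.ResolutionOfSingularities.ResolutionOfSingularities.Theorems.HilbertSamuelEliminationCampaignW42RidgeNumericalConfinement
import Summits.ResolutionOfSingularities.ResolutionOfSingularities.Theorems.HilbertSamuelEliminationCampaignW42PermissibleRidgeFibreCone
import Summits.ResolutionOfSingularities.ResolutionOfSingularities.Theorems.HilbertSamuelEliminationCampaignW42NearAlignment
import Summits.ResolutionOfSingularities.ResolutionOfSingularities.Theorems.HilbertSamuelEliminationCampaignW42NormalConeRidgePoint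
import Literature.RingTheory.HilbertSamuel.DirectrixQuasiEtale
import Literature.RingTheory.HilbertSamuel.FlatBaseChange
import HarnessLib

/-!
# [OURS · L1 W4.2] `RidgeDimMonotone p` UNCONDITIONALLY: at a near point of a permissible blow-up
# `dim F_{x'}(X') + tr.deg(κ(x')/κ(x)) ≤ dim F_x(X)` — and with it the full proposed typed signature
# `CampaignW42RidgeConfinement p` of stmt-ResolutionOfSingularities-17845, for every `p` and with NO named fact (campaign s42,
# cell res-hironaka; informal crux `RidgeConfinement`; `--supports`)

HONEST FRAMING. OURS (slot W4.2, prover res-L1-s42-pv-1, gen 5). The tree held `CampaignW42RidgeConfinement p` modulo CJS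
Thm. 3.10 (4) (`campaignW42RidgeConfinement_of_thm_3_10_4`, F-51-type binder `CossartJannsenSaito2020_thm_3_10_4`) and modulo
Dietel (8.2.7) (ii) (`campaignW42RidgeConfinement_of_dietel`, F-54). This file removes the binder: B. Dietel's Satz (8.2.7) (ii)
(«Rückgrat» half) is PROVED here for Giraud's ridge, in every characteristic and for arbitrary (imperfect) residue fields, by the
route of this generation's bricks B1–B7:

* `exists_localRidgeDim_add_le_of_isNearRing` — LOCAL RINGS. `(𝒪, 𝔫, k)` noetherian local universally catenary, `𝔭 = (c)`
  permissible (`𝒪/𝔭` regular of dimension `s`, normally flat) whose fibre-cone ideal `I(c) ⊆ k[Y]` has no linear forms (e.g. `c`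
  minimal), `𝒪' = 𝒪[𝔭/c_j]_𝔴` NEAR to `𝒪` (`IsNearRing`): then for `d = dim (R/𝔮) − 1` (`R` the local ring of the fibre cone at
  its vertex, `𝔮` the line of `x'`) one has `H⁽ᵈ⁺¹⁾(𝒪') = H⁽¹⁾(𝒪)` and **`dim F(𝒪') + d ≤ dim F(C_{X,D,x}) + s`**. Proof: the
  near chain (g3 `near_chain_equalities`) is all equalities; (A) Bennett equality at `𝔮` feeds the cone theorem
  `localRidgeDim_add_le_ridgeDim_of_hilbertFunQuot_le_hilbertSamuelFun` (B7): `dim F(R_𝔮) + (d+1) ≤ dim F(C_{X,D,x})`;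
  (B) Nagata's `𝒪'(X)` (`dim F` unchanged: flat, `𝔪 ↦ 𝔪`) cut by the `s + 1` sections `c_j, y_1, …, y_s` IS `R_𝔮` with
  `H⁽ˢ⁺¹⁾(R_𝔮) = H⁽⁰⁾(𝒪'(X))`, so `dim F(𝒪') ≤ dim F(R_𝔮) + s + 1` (B1b `localRidgeDim_le_localRidgeDim_add_of_hilbertSamuelFun_eq`).
* `ridgeDimDropAt_of_isNearPoint` — SCHEMES. `X` locally noetherian with `𝒪_{X,x}` universally catenary (e.g. excellent), `D`
  permissible at `x = π(x')`, `π` a blow-up in `D`, `x'` near at ANY level `N`: then `RidgeDimDropAt π x'`; here `d = tr.deg`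
  by the alignment `exists_trdeg_hilbertSamuelFun_eq_of_hsFun_eq` and `dim F_x(X) = dim F(C_{X,D,x}) + s` (Hironaka–Grothendieck).
* **`ridgeDimMonotone_holds (p) : RidgeDimMonotone p`** and **`campaignW42RidgeConfinement_holds (p) : CampaignW42RidgeConfinement p`**
  (with the tree's `campaignW42RidgeConfines_holds`, p513085): the proposed typed signature of stmt-17845 holds outright.

NOTHING here is a statement of H. Hironaka's manuscript [Hironaka2017]; nothing about resolution of singularities in positive
characteristic is asserted beyond this monotonicity of the ridge. AI review is weaker than expert review. References (orientation
only): B. Dietel, Dissertation Regensburg (2015), Satz (8.2.7) p. 105; V. Cossart, U. Jannsen, S. Saito, LNM 2270 (2020),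
Thm. 3.10, Thm. 3.14, Rem. 18.29 (1); J. Giraud, *Bull. Sci. Math.* 99 (1975) Cor. 2.4.
-/

noncomputable section

-- single-conjunct summit: the doubled namespace component `ResolutionOfSingularities` is mandated
set_option linter.dupNamespace false

open CategoryTheory AlgebraicGeometry TopologicalSpace IsLocalRing MvPolynomial Module
open Literature.AlgebraicGeometry.Resolution Literature.AlgebraicGeometry.Resolution.HironakaScheme
open Literature.RingTheory.HilbertSamuel Literature.RingTheory.MvPolynomial
open Literature.AlgebraicGeometry.CossartJannsenSaito2020
open Summit.ResolutionOfSingularities.ResolutionOfSingularities.Theorems.SigmaMaxModificationsCorridor3.Directrix214Sharp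

namespace Summit.ResolutionOfSingularities.ResolutionOfSingularities.Theorems

namespace CampaignW42

universe u

/-! ## Minimal generators have tangent cones without linear forms -/

/-- **No linear forms in the tangent cone ideal of a MINIMAL system of generators** (`H⁽⁰⁾(A)(1) = emb.dim A = e`, so
`dim J_1 = e − H(S/J)(1) = 0`). [cite: CossartJannsenSaito2020, §2.2 (p. 27)] -/
theorem finrank_idealDegree_tangentConeIdeal_one_eq_zero {A : Type u} [CommRing A] [IsLocalRing A] [IsNoetherianRing A]
    {e : ℕ} (he : (maximalIdeal A).spanFinrank = e) (x : Fin e → A) (hx : Ideal.span (Set.range x) = maximalIdeal A) :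
    finrank (ResidueField A) (idealDegree (tangentConeIdeal x hx) 1) = 0 := by
  classical
  haveI : Module.Finite (ResidueField A) (homogeneousSubmodule (Fin e) (ResidueField A) 1) :=
    Module.Finite.iff_fg.mpr (homogeneousSubmodule_fg (Fin e) (ResidueField A) 1)
  have hle : finrank (ResidueField A) (idealDegree (tangentConeIdeal x hx) 1) ≤ e := by
    have h := Submodule.finrank_mono (inf_le_right : idealDegree (tangentConeIdeal x hx) 1 ≤
      homogeneousSubmodule (Fin e) (ResidueField A) 1)
    rwa [finrank_homogeneousSubmodule_one] at h
  have h := congr_fun (hilbertFunQuot_tangentConeIdeal x hx) 1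
  rw [hilbertFun_one_eq_spanFinrank, he, hilbertFunQuot, finrank_homogeneousSubmodule_one] at h
  omega

/-- No linear forms survive the passage to fewer variables: if `J · K[X, T]` (`rename (castAdd s)`) has no linear forms then
neither has `J`. [folklore] -/
theorem finrank_idealDegree_one_eq_zero_of_map_rename {K : Type u} [Field K] {m : ℕ} (s : ℕ)
    (J : Ideal (MvPolynomial (Fin m) K))
    (h : finrank K (idealDegree (J.map ((rename (Fin.castAdd s) : MvPolynomial (Fin m) K →ₐ[K]
      MvPolynomial (Fin (m + s)) K) : MvPolynomial (Fin m) K →+* MvPolynomial (Fin (m + s)) K)) 1) = 0) :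
    finrank K (idealDegree J 1) = 0 := by
  classical
  set J' := J.map ((rename (Fin.castAdd s) : MvPolynomial (Fin m) K →ₐ[K] MvPolynomial (Fin (m + s)) K) :
    MvPolynomial (Fin m) K →+* MvPolynomial (Fin (m + s)) K) with hJ'
  haveI : Module.Finite K (homogeneousSubmodule (Fin (m + s)) K 1) :=
    Module.Finite.iff_fg.mpr (homogeneousSubmodule_fg (Fin (m + s)) K 1)
  haveI : Module.Finite K (idealDegree J' 1) :=
    Module.Finite.of_injective (Submodule.inclusion (inf_le_right : idealDegree J' 1 ≤ homogeneousSubmodule (Fin (m + s)) K 1))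
      (Submodule.inclusion_injective _)
  have hbot : idealDegree J' 1 = ⊥ := Submodule.finrank_eq_zero.mp h
  suffices hJbot : idealDegree J 1 = ⊥ by rw [hJbot, finrank_bot]
  rw [eq_bot_iff]
  intro f hf
  obtain ⟨hfJ, hfhom⟩ := mem_idealDegree.mp hf
  have hf' : rename (Fin.castAdd s) f ∈ idealDegree J' 1 :=
    mem_idealDegree.mpr ⟨Ideal.mem_map_of_mem _ hfJ, hfhom.rename_isHomogeneous⟩
  rw [hbot, Submodule.mem_bot] at hf'
  rw [Submodule.mem_bot]
  exact rename_injective _ (Fin.castAdd_injective m s) (by rw [hf', map_zero])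

/-! ## `dim F` of Nagata's `A(X) = A[X]_{𝔪A[X]}` -/

/-- **`dim F(A(X)) = dim F(A)`** (`A → A(X)` is flat with `𝔪 A(X) = 𝔪_{A(X)}`; Giraud's ridge dimension is `e_K` at a perfect
`K` over both residue fields). [cite: CossartJannsenSaito2020, Lemma 2.27 (1)] [cite: Dietel2015, (6.3.5)] -/
theorem localRidgeDim_localizedPolynomial (A : Type u) [CommRing A] [IsLocalRing A] [IsNoetherianRing A] :
    localRidgeDim (LocalizedPolynomial A) = localRidgeDim A := by
  have hm := map_maximalIdeal_localizedPolynomial A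
  haveI := isLocalHom_of_map_maximalIdeal_eq hm
  let K := AlgebraicClosure (ResidueField (LocalizedPolynomial A))
  letI : Algebra (ResidueField A) K :=
    ((algebraMap (ResidueField (LocalizedPolynomial A)) K).comp (ResidueField.map (algebraMap A (LocalizedPolynomial A)))).toAlgebra
  rw [localRidgeDim_eq_dirDimOver_of_perfectField (LocalizedPolynomial A) K, localRidgeDim_eq_dirDimOver_of_perfectField A K]
  exact dirDimOver_eq_of_flat_of_map_maximalIdeal_eq hm K rfl

/-! ## Local rings: the chart of a permissible blow-up at a near point -/

section Chart

variable {O : Type u} [CommRing O] [IsLocalRing O] [IsNoetherianRing O] {n : ℕ} (c : Fin n → O) (j : Fin n)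

local notation3 "𝔭" => Ideal.span (Set.range c)
local notation3 "hcj" => Ideal.mem_span_range_self (f := c) (x := j)

variable (P : Ideal (chartRing c j)) [P.IsPrime]
variable (O' : Type u) [CommRing O'] [Algebra (chartRing c j) O'] [IsLocalization.AtPrime O' P]
  [IsLocalRing O'] [IsNoetherianRing O'] [Algebra O O']

/-- **Dietel (8.2.7) (ii), ridge half, in the local rings — every characteristic, any residue field.** `𝒪` noetherian local
universally catenary, `𝔭 = (c_1, …, c_n)` permissible with `dim 𝒪/𝔭 = s` whose fibre-cone ideal `I(c) ⊆ k[Y]` has no linear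
forms, `𝒪' = 𝒪[𝔭/c_j]_𝔴` (`𝔴` over `𝔫`) near to `𝒪` at level `N`. Then there is `d` (`= dim R/𝔮 − 1`, the residual
transcendence degree) with `H⁽ᵈ⁺¹⁾(𝒪') = H⁽¹⁾(𝒪)` and `dim F(𝒪') + d ≤ dim F(C_{X,D,x}) + s` (`ridgeDim (fibreConeIdeal c) + s`).
[cite: Dietel2015, Satz (8.2.7) (ii) p. 105] [cite: CossartJannsenSaito2020, Thm. 3.10 (4), Rem. 18.29 (1)] -/
theorem exists_localRidgeDim_add_le_of_isNearRing (hO : IsUniversallyCatenaryRing O) [(𝔭).IsPrime]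
    [IsRegularLocalRing (O ⧸ 𝔭)] {s : ℕ} (hs : ringKrullDim (O ⧸ 𝔭) = s) (hNF : (𝔭).IsNormallyFlat)
    (hP : P.comap (chartBase c j) = maximalIdeal O)
    (hOO' : ∀ r : O, algebraMap O O' r = (algebraMap (chartRing c j) O' : chartRing c j →+* O') (chartBase c j r))
    {N : ℕ} (hnear : IsNearRing O O' N) (hI1 : finrank (ResidueField O) (idealDegree (fibreConeIdeal c) 1) = 0) :
    ∃ d : ℕ, hilbertSamuelFun O' (d + 1) = hilbertSamuelFun O 1 ∧
      localRidgeDim O' + d ≤ ridgeDim (fibreConeIdeal c) + s := by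
  classical
  haveI h𝔮 := isPrime_coneLocalPrime (c j) hcj P hP
  haveI h𝔓 := isPrime_chartConePrime c j P hP
  haveI := isNoetherianRing_chart c j
  obtain ⟨d, hd⟩ := exists_ringKrullDim_quotient_eq_nat (FibreConeLocal (𝔭)) (coneLocalPrime (c j) hcj P)
  obtain ⟨h1d, hBen, hVert, hOO⟩ := near_chain_equalities c j P O' hO hs hNF hP hOO' hnear hd
  -- (A) the cone theorem at the line `𝔮` of the fibre cone
  have hI𝔓 := fibreConeIdeal_le_chartConePrime c j P
  haveI := isPrime_map_quotientMk_of_le hI𝔓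
  have hdS : ringKrullDim (MvPolynomial (Fin n) (ResidueField O) ⧸ chartConePrime c j P) = d :=
    (ringKrullDim_quotient_chartConePrime_eq c j P hP).trans hd
  have hH : hilbertFunQuot (ResidueField O) n (fibreConeIdeal c) =
      hilbertSamuelFun (Localization.AtPrime (coneLocalPrime (c j) hcj P)) d := by
    rw [hBen, hilbertSamuelFun_zero, hilbertFun_fibreConeLocal_eq_hilbertFunQuot c]
  have hA : localRidgeDim (Localization.AtPrime (coneLocalPrime (c j) hcj P)) + d ≤ ridgeDim (fibreConeIdeal c) := by
    letI := algebraOfFibreCone c (Localization.AtPrime (coneLocalPrime (c j) hcj P))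
    haveI := isLocalization_atPrime_coneLocalPrime c j P hP
    exact localRidgeDim_add_le_ridgeDim_of_hilbertFunQuot_le_hilbertSamuelFun (isHomogeneousIdeal_fibreConeIdeal c) hI1
      hI𝔓 hdS rfl (Localization.AtPrime (coneLocalPrime (c j) hcj P)) hH.le
  -- (B) Nagata's `O'(X)` and its `s + 1` hypersurface sections down to `R_𝔮`
  haveI hlocq := isLocalRing_localizedPolynomial_quotient (c j) hcj P O' hP hOO'
  obtain ⟨x, hx⟩ := exists_maximalIdeal_eq_sup_span_range (𝔭) hs
  have hchain : hilbertSamuelFun (Localization.AtPrime (coneLocalPrime (c j) hcj P)) ((d - 1) + (s + 1)) =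
      hilbertSamuelFun O' ((d - 1) + 0) := by
    have h1 := hilbertSamuelFun_add_eq_of_eq hBen s
    rw [add_zero] at h1 ⊢
    rw [show d - 1 + (s + 1) = s + d by omega, h1, hVert, ← hOO]
  have hHq : hilbertSamuelFun (Localization.AtPrime (coneLocalPrime (c j) hcj P)) (s + 1) = hilbertFun O' := by
    have h := hilbertSamuelFun_eq_of_add_eq hchain
    rw [hilbertSamuelFun_zero] at h
    exact h
  have hHN : hilbertSamuelFun (LocalizedPolynomial O' ⧸ (maximalIdeal O).map (algebraMap O (LocalizedPolynomial O')))
      (s + 1) = hilbertFun (LocalizedPolynomial O') := by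
    rw [hilbertSamuelFun_localizedPolynomial_quotient_eq (c j) hcj P O' hP hOO' (s + 1), hHq, hilbertFun_localizedPolynomial]
  -- the `s + 1` generators `c_j, y_1, …, y_s` of `𝔫 O'(X)`
  let t : Fin (s + 1) → LocalizedPolynomial O' :=
    Fin.cons (algebraMap O (LocalizedPolynomial O') (c j)) fun k => algebraMap O (LocalizedPolynomial O') (x k)
  have hK : (maximalIdeal O).map (algebraMap O (LocalizedPolynomial O')) = Ideal.span (Set.range t) := by
    refine le_antisymm ?_ ?_
    · rw [hx, Ideal.map_sup, map_span_range_localizedPolynomial_eq c j O' hOO', Ideal.map_span]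
      refine sup_le ?_ ?_
      · rw [Ideal.span_singleton_le_iff_mem]
        exact Ideal.subset_span ⟨0, by simp only [t, Fin.cons_zero]⟩
      · rw [Ideal.span_le]
        rintro _ ⟨_, ⟨k, rfl⟩, rfl⟩
        exact Ideal.subset_span ⟨k.succ, by simp only [t, Fin.cons_succ]⟩
    · rw [Ideal.span_le]
      rintro _ ⟨k, rfl⟩
      refine Fin.cases ?_ (fun k => ?_) k
      · simp only [t, Fin.cons_zero]
        refine Ideal.mem_map_of_mem _ ?_
        rw [hx]
        exact Ideal.mem_sup_left hcj
      · simp only [t, Fin.cons_succ]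
        refine Ideal.mem_map_of_mem _ ?_
        rw [hx]
        exact Ideal.mem_sup_right (Ideal.subset_span ⟨k, rfl⟩)
  have hB : localRidgeDim (LocalizedPolynomial O') ≤
      localRidgeDim (LocalizedPolynomial O' ⧸ (maximalIdeal O).map (algebraMap O (LocalizedPolynomial O'))) + (s + 1) := by
    refine localRidgeDim_le_localRidgeDim_add_of_hilbertSamuelFun_eq ?_ t ?_ hHN
    · rw [Ideal.Quotient.algebraMap_eq]; exact Ideal.Quotient.mk_surjective
    · rw [Ideal.Quotient.algebraMap_eq, Ideal.mk_ker, hK]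
  -- (C) assemble
  obtain ⟨e⟩ := nonempty_ringEquiv_coneLocal_localizedPolynomial_quotient (c j) hcj P O' hP hOO'
  have hRq : localRidgeDim (LocalizedPolynomial O' ⧸ (maximalIdeal O).map (algebraMap O (LocalizedPolynomial O'))) =
      localRidgeDim (Localization.AtPrime (coneLocalPrime (c j) hcj P)) := (localRidgeDim_eq_of_ringEquiv e).symm
  have hRN : localRidgeDim (LocalizedPolynomial O') = localRidgeDim O' := localRidgeDim_localizedPolynomial O'
  refine ⟨d - 1, ?_, ?_⟩
  · have h := hilbertSamuelFun_add_eq_of_eq hOO 1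
    rw [add_zero, show 1 + (d - 1) = d - 1 + 1 by omega] at h
    exact h
  · rw [hRN, hRq] at hB
    omega

end Chart

/-! ## Schemes -/

section Schemes

variable {X X' : Scheme.{u}} [IsLocallyNoetherian X] [IsLocallyNoetherian X'] {π : X' ⟶ X} {D : X.IdealSheafData}

/-- **`dim F_{x'}(X') + tr.deg(κ(x')/κ(x)) ≤ dim F_x(X)` at a near point of a permissible blow-up — UNCONDITIONAL** (Dietel
(8.2.7) (ii) / CJS Rem. 18.29 (1), ridge form of Thm. 3.10 (4); every characteristic, any residue fields, any level `N`). `X`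
locally noetherian with `𝒪_{X,x}` universally catenary, `D` permissible at `x = π(x')`, `π` a blow-up in `D`,
`H^N_{X'}(x') = H^N_X(x)`: then `RidgeDimDropAt π x'`. [cite: Dietel2015, Satz (8.2.7) (ii) p. 105]
[cite: CossartJannsenSaito2020, Thm. 3.10 (4), Rem. 18.29 (1)] -/
theorem ridgeDimDropAt_of_isNearPoint (hπ : IsBlowup π D) (x' : X') (hperm : IdealSheafData.IsPermissibleAt D (π.base x'))
    (hUC : IsUniversallyCatenaryRing (X.presheaf.stalk (π.base x'))) {N : ℕ} (hnear : IsNearPoint π N x') :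
    RidgeDimDropAt π x' := by
  classical
  have hIperm : (stalkIdeal D (π.base x')).IsPermissible := hperm
  -- minimal generators `(g, y)` of `𝔫 = 𝔪_{X,x}` adapted to `D`, and `dim F_x(X) = dim F(C_{X,D,x}) + s`
  obtain ⟨n, s, g, y, hz, hgI, hn, hdimI, hE, hJz⟩ :=
    exists_minimal_generators_data HerrmannIkedaOrbanz1988_cor_21_11_holds hIperm
  let L := AlgebraicClosure (ResidueField (X.presheaf.stalk (π.base x')))
  have hR : Scheme.ridgeDim X (π.base x') = ridgeDim (normalConeIdeal g) + s := by
    change localRidgeDim (X.presheaf.stalk (π.base x')) = _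
    rw [localRidgeDim_eq_dirDimOver_of_perfectField (X.presheaf.stalk (π.base x')) L,
      dirDimOver_eq' (X.presheaf.stalk (π.base x')) L hE (Fin.append g y) hz, hJz, map_map_rename_eq,
      directrixDim_map_rename_castAdd]
    congr 1
    exact (radical_ridgeIdeal_coneIdeal_eq_and_ridgeDim_eq (normalConeIdeal g) (isHomogeneousIdeal_normalConeIdeal g) L).2.symm
  -- no linear forms in `I(g)` (the generators are minimal)
  have hI1 : finrank (ResidueField (X.presheaf.stalk (π.base x'))) (idealDegree (fibreConeIdeal g) 1) = 0 := by
    rw [fibreConeIdeal_eq_normalConeIdeal]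
    refine finrank_idealDegree_one_eq_zero_of_map_rename s (normalConeIdeal g) ?_
    rw [← hJz]
    exact finrank_idealDegree_tangentConeIdeal_one_eq_zero hE (Fin.append g y) hz
  -- the Rees chart presenting `𝒪_{X',x'}`
  obtain ⟨j, 𝔴, χ, hχ, hloc, h𝔴⟩ := hπ.exists_reesChart_stalk x' g hgI
  letI algCO : Algebra (chartRing g j) (X'.presheaf.stalk x') := χ.toAlgebra
  letI algRO : Algebra (X.presheaf.stalk (π.base x')) (X'.presheaf.stalk x') := (π.stalkMap x').hom.toAlgebra
  haveI : IsLocalization.AtPrime (X'.presheaf.stalk x') 𝔴.asIdeal := hloc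
  have hp : (Ideal.span (Set.range g)).IsPermissible := by rw [hgI]; exact hIperm
  haveI : IsRegularLocalRing (X.presheaf.stalk (π.base x') ⧸ Ideal.span (Set.range g)) := hp.1
  haveI : IsDomain (X.presheaf.stalk (π.base x') ⧸ Ideal.span (Set.range g)) := isDomain_of_isRegularLocalRing _
  haveI : (Ideal.span (Set.range g)).IsPrime := (Ideal.Quotient.isDomain_iff_prime _).mp inferInstance
  have hs : ringKrullDim (X.presheaf.stalk (π.base x') ⧸ Ideal.span (Set.range g)) = s := by rw [hgI]; exact hdimI
  have hOO' : ∀ r : X.presheaf.stalk (π.base x'),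
      algebraMap (X.presheaf.stalk (π.base x')) (X'.presheaf.stalk x') r =
        (algebraMap (chartRing g j) (X'.presheaf.stalk x') : chartRing g j →+* X'.presheaf.stalk x') (chartBase g j r) :=
    fun r => (hχ r).symm
  have hnear' : IsNearRing (X.presheaf.stalk (π.base x')) (X'.presheaf.stalk x') N := by
    unfold IsNearRing
    have h := hnear
    rw [IsNearPoint, Scheme.hsFun_def, Scheme.hsFun_def] at h
    exact h
  obtain ⟨d, hHd, hRd⟩ := exists_localRidgeDim_add_le_of_isNearRing g j 𝔴.asIdeal (X'.presheaf.stalk x') hUC hs hp.2.1 h𝔴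
    hOO' hnear' hI1
  -- `d = tr.deg(κ(x')/κ(x))` by the alignment
  obtain ⟨d', htr, -, hH'⟩ := exists_trdeg_hilbertSamuelFun_eq_of_hsFun_eq hπ x' hperm hUC N hnear
  have hdd : d' = d := by
    have h := hilbertSamuelFun_index_injective (hH'.trans hHd.symm)
    omega
  -- assemble in `Cardinal`
  unfold RidgeDimDropAt
  have htr' : @Algebra.trdeg (X.residueField (π.base x')) (X'.residueField x') _ _ (residueAlgebra π x') = (d : Cardinal.{u}) := by
    rw [← hdd]; exact htr
  rw [htr', hR]
  have hfin : Scheme.ridgeDim X' x' + d ≤ ridgeDim (normalConeIdeal g) + s := by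
    rw [← fibreConeIdeal_eq_normalConeIdeal]; exact hRd
  exact_mod_cast hfin

/-- **`RidgeDimDropAt` at a near point of a permissible blow-up of an EXCELLENT scheme** (the hypotheses of the binder
`ridgeDimDropAt_of_thm_3_10_4`, now without the binder and without `N ≥ dim X`). [cite: Dietel2015, Satz (8.2.7) (ii) p. 105] -/
theorem ridgeDimDropAt_of_isNearPoint_of_isExcellent (hX : Scheme.IsExcellent X) (hD : IdealSheafData.IsPermissible D)
    (hπ : IsBlowup π D) {N : ℕ} (x' : X') (hx : π.base x' ∈ (D.support : Set X)) (hnear : IsNearPoint π N x') :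
    RidgeDimDropAt π x' :=
  ridgeDimDropAt_of_isNearPoint hπ x' (hD _ hx) (hX.isUniversallyCatenaryRing_stalk _) hnear

/-- **`RidgeDimMonotone p` holds for every `p`, unconditionally** (the second conjunct of the proposed typed signature of
stmt-ResolutionOfSingularities-17845): reduced separated schemes of finite type over a field are excellent.
[cite: Dietel2015, Satz (8.2.7) (ii) p. 105] [cite: CossartJannsenSaito2020, Rem. 18.29 (1)] -/
theorem ridgeDimMonotone_holds (p : ℕ) : RidgeDimMonotone.{u} p := by
  intro k _ _ X _ f _ hft _ _ D hD X' _ π hπ N _ x' hx hnear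
  haveI := hft
  have hexc : Scheme.IsExcellent X := Scheme.isExcellent_of_locallyOfFiniteType Stacks07QW_field_holds f
  exact ridgeDimDropAt_of_isNearPoint_of_isExcellent hexc hD hπ x' hx hnear

/-- **`CampaignW42RidgeConfinement p` — the full proposed typed signature of stmt-ResolutionOfSingularities-17845 — holds for every
`p`, with NO named fact**: ridge confinement (`campaignW42RidgeConfines_holds`, p513085) and ridge monotonicity
(`ridgeDimMonotone_holds`). Supersedes `campaignW42RidgeConfinement_of_thm_3_10_4` (mod CJS 3.10 (4)) and
`campaignW42RidgeConfinement_of_dietel` (mod F-54). [cite: Dietel2015, Satz (8.2.7) (ii) p. 105] [cite: Giraud1975, Cor. 2.4]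
[cite: CossartJannsenSaito2020, Thm. 3.14, Rem. 18.29 (1)] -/
theorem campaignW42RidgeConfinement_holds (p : ℕ) : CampaignW42RidgeConfinement.{u} p :=
  ⟨campaignW42RidgeConfines_holds p, ridgeDimMonotone_holds p⟩

end Schemes

end CampaignW42

end Summit.ResolutionOfSingularities.ResolutionOfSingularities.Theorems

end
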